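import Summits.Parity.GeneralizedHardyLittlewood.Theorems.LeeYangFibresFibrationLemmaAveragingEstimate
import Summits.Parity.GeneralizedHardyLittlewood.Theorems.LeeYangFibresFibrationLemmaAvgErrorSmall
import Summits.Parity.GeneralizedHardyLittlewood.Theorems.LeeYangFibresFibrationLemmaGlue
import HarnessLib

/-!
# Fibration lemma (`DimOne → GeneralizedHardyLittlewood`): the final theorem

Support file for the statement item `FibrationLemma : DimOne → GeneralizedHardyLittlewood`
(stmt-Parity-0822, shared by the `d = 1` routes of `Summits/Parity/GeneralizedHardyLittlewood`; here
for route `LeeYangFibres`, whose `Assembly` (stmt-Parity-14612) composes through it). Green–Tao's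
fibration remark (2010, §1, after Conj. 1.2: a `d`-parameter version of the one-dimensional conjecture
"would follow easily by holding `d − 1` of the variables fixed and summing in the remaining one") is
formalised in the `LeeYangFibresFibrationLemma*` files; this file closes it:

* `fibreAveraging` — the RIGHT half in the shape consumed by the glue
  (`FibrationGlue.generalizedHardyLittlewood_of_fibreAveraging`): for the standing data `S` of the fibre
  argument, `|∑_{w good} ℓ(w) 𝔖(Φ_w) − vol(K) 𝔖(Ψ)| ≤ ε N^{d+1}` once `N ≥ N₀(d, t, L, ε)` — the averaging
  lemma `FibreSetting.abs_fibreMainSum_lim_sub_le` (part 9b) at the truncation `z = z(N)` (part 10a),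
  whose error `avgError(N, z(N))` is `o(N^{d+1})` (`avgError_zOf_le_eventually`, part 10c);
* `generalizedHardyLittlewood_of_dimOne` — **the fibration lemma**, Theses-free: the one-dimensional
  conjecture (Green–Tao's Conj. 1.2 at `d = 1`, the common unfolded body of every route's `DimOne`)
  implies `Literature.NumberTheory.Sieve.GeneralizedHardyLittlewood` in full. Each route's
  `FibrationLemma : DimOne → GeneralizedHardyLittlewood` is the one-line wrapper
  `fun hDim => FibrationGlue.generalizedHardyLittlewood_of_dimOne hDim`.

References: B. Green, T. Tao, *Linear equations in primes*, Ann. of Math. 171 (2010), §1 (Conj. 1.2 and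
the remark following it), App. A [GreenTao2010]. No named facts are used (the inputs — Green–Tao's
Lemma 1.3 `tendsto_singularProductPartial_holds`, the lattice point count of App. A, Mertens' bounds —
are proved in the tree).
-/

noncomputable section

open Finset MeasureTheory

namespace Summit.Parity.GeneralizedHardyLittlewood.Theorems.FibrationGlue

open Literature.NumberTheory.Sieve

/-- **The RIGHT half of the fibration argument** (averaging of the fibre main terms, asymptotic form):
for `d, t ≥ 1`, `L` and `ε > 0` there is `N₀` such that for every standing datum `S = (Ψ, L, N, K)` of
the fibre argument with `N ≥ N₀`,
`|∑_{w ∈ goodSet} ℓ(w) 𝔖(Φ_w) − vol(K) 𝔖(Ψ)| ≤ ε N^{d+1}`. Proof: part 9b's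
`abs_fibreMainSum_lim_sub_le` with `z = zOf d N` (legitimate once `(16^d)^{P₀+2} ≤ N`, `P₀` the tail
threshold, and `t² ≤ N`) bounds the left side by `avgError d t L N (zOf d N)`, which is `≤ ε N^{d+1}`
for `N ≥ N₁` by `avgError_zOf_le_eventually`; `L = 0` admits no standing datum (`FibreSetting.one_le_L`).
[cite: GreenTao2010, §1 (remark after Conj. 1.2)] -/
theorem fibreAveraging :
    ∀ (d t L : ℕ), 1 ≤ d → 1 ≤ t → ∀ ε : ℝ, 0 < ε → ∃ N₀ : ℕ, ∀ S : FibreSetting d t,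
        S.L = L → N₀ ≤ S.N →
          |∑ w ∈ goodSet S.Ψ S.N, S.ell w * singularProduct (fibreSystem S.Ψ w) -
              (volume S.K).toReal * singularProduct S.Ψ| ≤ ε * (S.N : ℝ) ^ (d + 1) := by
  intro d t L hd ht ε hε
  by_cases hL : 1 ≤ L
  · obtain ⟨N₁, hN₁⟩ := avgError_zOf_le_eventually hd ht hL hε
    refine ⟨max N₁ (max ((16 ^ d) ^ (tailThreshold t L + 2)) (t * t)), fun S hSL hN => ?_⟩
    have hNN₁ : N₁ ≤ S.N := (le_max_left _ _).trans hN
    have hN16 : (16 ^ d) ^ (tailThreshold t L + 2) ≤ S.N :=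
      (le_max_left _ _).trans ((le_max_right _ _).trans hN)
    have hNtt : t * t ≤ S.N := (le_max_right _ _).trans ((le_max_right _ _).trans hN)
    have hz : tailThreshold t L + 2 ≤ zOf d S.N := le_zOf hd hN16
    have hz1 : tailThreshold t S.L ≤ zOf d S.N := by rw [hSL]; omega
    have hz2 : 2 ≤ zOf d S.N := by omega
    have hNt : t * t < 2 * S.N + 1 := lt_of_le_of_lt hNtt (by omega)
    calc |∑ w ∈ goodSet S.Ψ S.N, S.ell w * singularProduct (fibreSystem S.Ψ w) -
            (volume S.K).toReal * singularProduct S.Ψ|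
        ≤ avgError d t S.L S.N (zOf d S.N) := S.abs_fibreMainSum_lim_sub_le hz1 hz2 hNt
      _ ≤ ε * (S.N : ℝ) ^ (d + 1) := by rw [hSL]; exact hN₁ S.N hNN₁
  · exact ⟨0, fun S hSL _ => absurd (hSL ▸ S.one_le_L) hL⟩

/-- **The fibration lemma** (Green–Tao 2010, remark after Conjecture 1.2), Theses-free: the
one-dimensional generalised Hardy–Littlewood conjecture — for all `t ≥ 1`, `L`, uniformly over
non-degenerate systems `Φ` of `t` affine-linear forms on `ℤ` with `‖Φ‖_N ≤ L` and convex `K ⊆ [-N, N]`,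
`∑_{n ∈ K ∩ ℤ} ∏ᵢ Λ(φᵢ(n)) = β_∞ ∏_p β_p + o_{t,L}(N)` — implies Conjecture 1.2 in every dimension `d`
("holding `d − 1` of the variables fixed and summing in the remaining one"): the LEFT half
(`DimOne` on the good fibres, `FibrationFibreSums.fibreSums_estimate`), the RIGHT half (`fibreAveraging`)
and the lift to non-zero last coefficients (`FibrationLift.generalizedHardyLittlewood_of_lastCoeff`),
combined by `generalizedHardyLittlewood_of_fibreAveraging`. [cite: GreenTao2010, §1 (remark after Conj. 1.2)] -/
theorem generalizedHardyLittlewood_of_dimOne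
    (hDim : ∀ (t L : ℕ), 1 ≤ t → ∀ ε : ℝ, 0 < ε → ∃ N₀ : ℕ, ∀ N : ℕ, N₀ ≤ N →
      ∀ Φ : Fin t → AffLinForm 1, IsNondegenerateSystem Φ → affLinSize Φ N ≤ L →
        ∀ K : Set (Fin 1 → ℝ), Convex ℝ K → K ⊆ realBox 1 N →
          |vonMangoldtSum Φ K N - archFactor Φ K * singularProduct Φ| ≤ ε * (N : ℝ)) :
    GeneralizedHardyLittlewood :=
  generalizedHardyLittlewood_of_fibreAveraging fibreAveraging hDim

end Summit.Parity.GeneralizedHardyLittlewood.Theorems.FibrationGlue
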